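import Summits.AtomisticToContinuum.HydrodynamicLimit.Theses.LambertianContactSwap
import Literature.Analysis.FluidPDE.HardSphereFlowMeasurable
import Literature.MathematicalPhysics.KineticTheory.HardSphereEulerProofs
import HarnessLib

/-!
# Stub `stub_meas` of the line `Sketch` of the crux `ContactAngleEquidistribution`
# (stmt-AtomisticToContinuum-12097, route LambertianContactSwap)

Registered stub of the lead skeleton `Cruxes/ContactAngleEquidistribution/Lines/Sketch.lean`
(namespace `…Cruxes.ContactAngleEquidistribution.Sketch`); the signature below is VERBATIM the
registered one.

## Statement and proof outline

The functional is a marked collision sum over Alexander's collision-by-collision construction of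
the hard-sphere flow on `T³` (`Literature.Analysis.FluidPDE.HardSphereFlowConstruction`): for the
collisions `m < collisionCount z t` in `[0, t]`, a jointly measurable real mark `f (s, y, i, j)` is
read at the collision instant `s = t_{m+1}`, on the pre-collisional configuration
`y = S_{τ(z_m)} z_m` and on the ordered pair `(i, j)` selected by the incoming-contact condition
`hit`. We prove that the sum is a measurable function of the initial datum `z`.

* The torus geometry is hard-sphere regular at diameter `hsDiameter σ N ≤ σ < 1/2`
  (`Torus.isHardSphereRegular_geometry`, `hsDiameter_le`) and measurable
  (`Torus.isMeasurable_geometry`), so the measurability layer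
  `Literature.Analysis.FluidPDE.HardSphereFlowMeasurable` applies: `stateAfter · m`,
  `freeExitTime`, `collisionInstant · k`, `collisionCount · t` are measurable, and free flight is
  jointly measurable in (time, datum). Hence the pre-collisional configuration `zpre z m`, the
  instant `tcol z m`, and the `hit` event (preimage of the measurable `contactSet` and
  `IsIncoming` sets) are measurable for each fixed `m`, and so is each summand (`Measurable.ite`).
* The range of summation `Finset.range (collisionCount z t)` depends on `z`: the sum is the
  composition of the measurable map `z ↦ (collisionCount z t, z)` with
  `(k, z) ↦ ∑_{m < k} u m z`, which is measurable on `ℕ × Cfg` because `ℕ` is countable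
  with measurable singletons (`measurable_from_prod_countable_right`), exactly as in
  `Alexander.measurable_fwdFlow`.

## References

* C. Cercignani, R. Illner, M. Pulvirenti, *The Mathematical Theory of Dilute Gases*, Springer
  (1994), §4.2, App. 4.A–4.B (the flow `T^t` and its collision sequence are Borel).
* I. Gallagher, L. Saint-Raymond, B. Texier, *From Newton to Boltzmann*, EMS (2013), §4.1–4.2.
-/

noncomputable section

open MeasureTheory Filter Set Topology ProbabilityTheory
open scoped ENNReal BigOperators Classical

namespace Summit.AtomisticToContinuum.HydrodynamicLimit.Theorems.ContactAngleEquidistributionSketch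

open Literature.Analysis.FluidPDE Literature.MathematicalPhysics.KineticTheory
open Summit.AtomisticToContinuum.HydrodynamicLimit.Theses.LambertianContactSwap

/-- STUB `meas` of line `Sketch` (crux ContactAngleEquidistribution, stmt-AtomisticToContinuum-12097): every marked collision sum over Alexander's construction — a measurable real mark of (collision instant, pre-collisional configuration, ordered pair), read on the `hit`-selected pair of each of the `collisionCount` collisions in `[0, t]` — is a measurable function of the initial datum. [folklore] -/
theorem stub_meas :
    let Cfg : ℕ → Type := fun N => Config (N + 1) (Fin 3) T3
    let G := Torus.geometry (Fin 3)
    let ε : ℝ → ℕ → ℝ := hsDiameter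
    let τ : ℝ → (N : ℕ) → Cfg N → ℝ≥0∞ := fun σ N z => Alexander.freeExitTime G (ε σ N) z
    let S : ℝ → (N : ℕ) → Cfg N → Cfg N := fun t _ z => freeFlight G t z
    let zpre : ℝ → (N : ℕ) → Cfg N → ℕ → Cfg N := fun σ N z m =>
      let y := Alexander.stateAfter G (ε σ N) z m; S (τ σ N y).toReal N y
    let Kt : ℝ → (N : ℕ) → Cfg N → ℝ → ℕ := fun σ N z t => Alexander.collisionCount G (ε σ N) z t
    let hit : ℝ → (N : ℕ) → Cfg N → Fin (N + 1) → Fin (N + 1) → Prop := fun σ N y i j =>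
      i < j ∧ y ∈ contactSet G (N + 1) (ε σ N) i j ∧ IsIncoming G y i j
    let tcol : ℝ → (N : ℕ) → Cfg N → ℕ → ℝ := fun σ N z m =>
      (Alexander.collisionInstant G (ε σ N) z (m + 1)).toReal
    ∀ σ : ℝ, 0 < σ → σ < 2⁻¹ → ∀ (N : ℕ) (t : ℝ)
      (f : ℝ → Cfg N → Fin (N + 1) → Fin (N + 1) → ℝ),
      (∀ i j, Measurable (fun p : ℝ × Cfg N => f p.1 p.2 i j)) →
      Measurable (fun z : Cfg N => ∑ m ∈ Finset.range (Kt σ N z t),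
        ∑ i : Fin (N + 1), ∑ j : Fin (N + 1),
          (if hit σ N (zpre σ N z m) i j then f (tcol σ N z m) (zpre σ N z m) i j else 0)) := by
  intro Cfg G ε τ S zpre Kt hit tcol σ hσ hσh N t f hf
  -- the torus geometry is hard-sphere regular at diameter `ε σ N ≤ σ < 1/2`, and measurable
  have hG : G.IsHardSphereRegular (ε σ N) :=
    Torus.isHardSphereRegular_geometry ((hsDiameter_le hσ.le N).trans_lt hσh)
  have hGm : G.IsMeasurable := Torus.isMeasurable_geometry
  -- measurable building blocks, collision by collision
  have hstate : ∀ m, Measurable fun z : Cfg N => Alexander.stateAfter G (ε σ N) z m :=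
    fun m => Alexander.measurable_stateAfter hG hGm m
  have hzpre : ∀ m, Measurable fun z : Cfg N => zpre σ N z m := fun m =>
    hGm.measurable_freeFlight₂.comp
      ((((Alexander.measurable_freeExitTime hG hGm).comp (hstate m)).ennreal_toReal).prodMk
        (hstate m))
  have htcol : ∀ m, Measurable fun z : Cfg N => tcol σ N z m := fun m =>
    (Alexander.measurable_collisionInstant hG hGm (m + 1)).ennreal_toReal
  have hhit : ∀ m i j, MeasurableSet {z : Cfg N | hit σ N (zpre σ N z m) i j} := fun m i j =>
    measurableSet_setOf.2 (measurable_const.and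
      ((measurableSet_setOf.1 ((measurableSet_contactSet G hGm.measurable_sepVec (N + 1) (ε σ N)
        i j).preimage (hzpre m))).and
        (measurableSet_setOf.1 ((hGm.measurableSet_isIncoming i j).preimage (hzpre m)))))
  -- a sum of measurable functions over a measurably varying initial segment of `ℕ` is
  -- measurable: factor through `ℕ × Cfg N`, countable first factor
  have key : ∀ u : ℕ → Cfg N → ℝ, (∀ m, Measurable (u m)) →
      Measurable fun z => ∑ m ∈ Finset.range (Kt σ N z t), u m z := by
    intro u hu
    have hF : Measurable fun p : ℕ × Cfg N => ∑ m ∈ Finset.range p.1, u m p.2 :=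
      measurable_from_prod_countable_right fun k =>
        Finset.measurable_sum (Finset.range k) fun m _ => hu m
    exact hF.comp ((Alexander.measurable_collisionCount hG hGm t).prodMk measurable_id)
  refine key _ fun m => Finset.measurable_sum _ fun i _ => Finset.measurable_sum _ fun j _ => ?_
  exact Measurable.ite (hhit m i j) ((hf i j).comp ((htcol m).prodMk (hzpre m))) measurable_const

end Summit.AtomisticToContinuum.HydrodynamicLimit.Theorems.ContactAngleEquidistributionSketch

end
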